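import Summits.NavierStokesRegularity.NavierStokesRegularity.Theses.QuantisedSymmetry
import Summits.NavierStokesRegularity.NavierStokesRegularity.Theses.Blowup
import Summits.NavierStokesRegularity.NavierStokesRegularity.Theorems.QuantisedSymmetryLiouvilleKillsProfile
import Summits.NavierStokesRegularity.NavierStokesRegularity.Theorems.QuantisedSymmetryPolyhedralTruncationBridge
import Summits.NavierStokesRegularity.NavierStokesRegularity.Theorems.QuantisedSymmetryPolyhedralDssProfileExistsDominatesBlowupProfile
import Summits.NavierStokesRegularity.NavierStokesRegularity.Theorems.SymmetryModuliCountSymmetricLiouvilleRotationCovariance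
import Literature.Analysis.FluidPDE.TypeIAncientMild
import Literature.Analysis.FluidPDE.TypeIAncientMildRescale
import Literature.Analysis.FluidPDE.MildSolutionIsometryCovariance
import Literature.Analysis.FluidPDE.SelfSimilar
import HarnessLib

/-!
# Strategist sketch s19-g3 (family `s`, second independent census) for the crux
`QuantisedSymmetry.PolyhedralDssProfileExists` (stmt-NavierStokesRegularity-1404)

Kernel-checked support for `STRATEGY-CENSUS-s19.md` (gen 3). Nothing here is a route item; every
`def` is census material. Contents:

* §A  the weaker-intermediate ladder: the crux `X` decides `¬ NavierStokesRegularity` with LANDED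
  co-binders (`crux_decides`), dominates the plain Type-I DSS profile of route `Blowup`
  (`crux_implies_blowupProfile`), and implies the one strictly-weaker NON-deciding intermediate
  `W1 = ¬ PolyhedralTypeILiouville` (`crux_implies_W1`); `W1` decides the summit only through the
  OPEN bridge `B1` (`closes_W1`).
* §B  the best typed decomposition found ("symmetric data + uniqueness ⇒ symmetric solution",
  applied to the blow-up-time trace): `SymmetricScarAttained ∧ TraceRigidity → X`, assembly
  PROVED (`polyhedralDssProfileExists_of_scar_rigidity`).
-/

set_option linter.dupNamespace false

noncomputable section

open MeasureTheory Set Filter Function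
open scoped Topology
open Literature.Analysis.FluidPDE

namespace Summit.NavierStokesRegularity.NavierStokesRegularity.Cruxes.PolyhedralDssProfileExists.StrategistS19g3

open Summit.NavierStokesRegularity.NavierStokesRegularity.Theses.QuantisedSymmetry
open Summit.NavierStokesRegularity.NavierStokesRegularity

/-! ## §A The weaker-intermediate ladder -/

/-- The crux ALONE decides the sub-problem: its two co-binders in `closes` are landed theorems. -/
theorem crux_decides (hX : PolyhedralDssProfileExists) : ¬ _root_.NavierStokesRegularity :=
  closes hX Theorems.quantisedSymmetry_polyhedralTruncationBridge_proof ClayUniqueness_holds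

/-- `X ⇒ W` (plain Type-I DSS profile, route `Blowup`'s deciding crux; landed, lead c15). -/
theorem crux_implies_blowupProfile (hX : PolyhedralDssProfileExists) :
    Theses.Blowup.BlowupTypeIDssProfile :=
  Theorems.PolyhedralDssProfileExists.PolyhedralCell.stub_dominatesBlowupProfile hX

/-- `W1`: the one strictly-weaker intermediate that does NOT already decide the summit by landed
theorems — failure of the polyhedral Type-I Liouville theorem (item #3 negated; DSS dropped). -/
def W1 : Prop := ¬ PolyhedralTypeILiouville

/-- `X ⇒ W1` (contrapositive of the landed support item `LiouvilleKillsProfile`). -/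
theorem crux_implies_W1 (hX : PolyhedralDssProfileExists) : W1 :=
  fun hL => Theorems.quantisedSymmetry_liouvilleKillsProfile_proof hL hX

/-- `B1`: the OPEN bridge `W1` would need — a nontrivial polyhedrally equivariant Type-I bounded
ancient mild solution (no self-similarity) yields a Clay blow-up datum. Only its DSS case is landed
(`PolyhedralTruncationBridge`, pseudo-stable steering of the PERIOD map). -/
def B1 : Prop :=
  ∀ G : Subgroup (EuclideanSpace ℝ (Fin 3) ≃ₗᵢ[ℝ] EuclideanSpace ℝ (Fin 3)), Finite G →
    (∀ g ∈ G, LinearMap.det (g.toLinearEquiv : EuclideanSpace ℝ (Fin 3) →ₗ[ℝ] EuclideanSpace ℝ (Fin 3)) = 1) →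
    (∀ V : Submodule ℝ (EuclideanSpace ℝ (Fin 3)), (∀ g ∈ G, ∀ v ∈ V, g v ∈ V) → V = ⊥ ∨ V = ⊤) →
    ∀ u : ℝ → EuclideanSpace ℝ (Fin 3) → EuclideanSpace ℝ (Fin 3),
      IsBoundedAncientMildSolution 1 u → (∀ t < 0, AEStronglyMeasurable (u t) volume) →
      (∃ C₀ : ℝ, HasTypeIDecay C₀ u) → (∀ g ∈ G, ∀ t x, u t (g x) = g (u t x)) →
      ¬ (∀ t < 0, u t =ᵐ[volume] 0) →
      ∃ ν : ℝ, 0 < ν ∧ ∃ T : ℝ, 0 < T ∧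
        ∃ (v : ℝ → EuclideanSpace ℝ (Fin 3) → EuclideanSpace ℝ (Fin 3)) (p : ℝ → EuclideanSpace ℝ (Fin 3) → ℝ),
          IsMaximalSmoothSolution ν 0 v p T ∧ IsLerayHopfOn T ν 0 (v 0) v ∧ HasRapidSpatialDecay (v 0)

/-- The deciding theorem of the hypothetical `W1`-route: same logic as the route's `closes`, with
the open bridge `B1` in place of the landed `PolyhedralTruncationBridge`. -/
theorem closes_W1 (hW : W1) (hB : B1) (hU : ClayUniqueness) : ¬ _root_.NavierStokesRegularity := by
  rintro hA
  unfold W1 PolyhedralTypeILiouville at hW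
  push Not at hW
  obtain ⟨G, hfin, hdet, hirr, w, hanc, hmeas, hdec, heqv, hnt⟩ := hW
  have hnt' : ¬ (∀ t < 0, w t =ᵐ[volume] 0) := by
    obtain ⟨t, ht, hne⟩ := hnt
    exact fun h => hne (h t ht)
  obtain ⟨ν, hν, T, hT, u, p, ⟨hcl, hmax⟩, hLH, hdecay⟩ :=
    hB G hfin hdet hirr w hanc hmeas hdec heqv hnt'
  have h0 : (0 : ℝ) ∈ Set.Ico 0 T := ⟨le_rfl, hT⟩
  obtain ⟨u', p', hu', hp', hns, hbe⟩ :=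
    hA ν hν (u 0) (hcl.contDiff_velocity h0) (hcl.divFree 0 h0) hdecay
  have heq : ∀ t ∈ Set.Ico 0 T, u' t = u t :=
    hU ν hν (u 0) hdecay u' u p' p T hT hu' hp' hns hbe hcl hLH rfl
  have hcl' : IsClassicalNSSolutionOn (Set.Ici 0) ν 0 u' p' :=
    ⟨hu', hp', fun t ht x => hns.momentum t ht x, fun t ht => hns.divFree t ht⟩
  refine hmax ⟨T + 1, by linarith, u', p', ?_, heq⟩
  exact hcl'.mono (fun t ht => ht.1) (uniqueDiffOn_Ico 0 (T + 1))

/-! ## §B The scar/rigidity decomposition -/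

/-- The class in which blow-up-time traces are taken: Oseen-gauge (KNSS) Type-I ancient mild
fields with Type-I space–time decay (the setting of the lead's N18 `stub_blowupTrace`). -/
def InTraceClass (V : ℝ → EuclideanSpace ℝ (Fin 3) → EuclideanSpace ℝ (Fin 3)) : Prop :=
  ∃ C C₀ : ℝ, IsTypeIAncientMild C V ∧ HasTypeIDecay C₀ V

/-- `V₀` is the blow-up-time trace ("scar") of `V` off the origin: `V(t,x) → V₀(x)` as `t ↑ 0`,
`x ≠ 0` (pointwise; N18). -/
def HasBlowupTrace (V : ℝ → EuclideanSpace ℝ (Fin 3) → EuclideanSpace ℝ (Fin 3))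
    (V₀ : EuclideanSpace ℝ (Fin 3) → EuclideanSpace ℝ (Fin 3)) : Prop :=
  ∀ x, x ≠ 0 → Tendsto (fun t => V t x) (𝓝[<] 0) (𝓝 (V₀ x))

/-- Piece T1 (the `∃` half): some NONZERO scar which is `λ`-homogeneous of degree `-1` and
equivariant under a finite irreducible rotation group is ATTAINED by an element of the trace class.
No self-similarity or equivariance is asked of the solution — only of its scar. A consequence of
`X` (N9 smooth representative + N18 trace + N24 scar `≢ 0`). -/
def SymmetricScarAttained : Prop :=
  ∃ G : Subgroup (EuclideanSpace ℝ (Fin 3) ≃ₗᵢ[ℝ] EuclideanSpace ℝ (Fin 3)), Finite G ∧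
    (∀ g ∈ G, LinearMap.det (g.toLinearEquiv : EuclideanSpace ℝ (Fin 3) →ₗ[ℝ] EuclideanSpace ℝ (Fin 3)) = 1) ∧
    (∀ V : Submodule ℝ (EuclideanSpace ℝ (Fin 3)), (∀ g ∈ G, ∀ v ∈ V, g v ∈ V) → V = ⊥ ∨ V = ⊤) ∧
    ∃ c : ℝ, 1 < c ∧ ∃ V₀ : EuclideanSpace ℝ (Fin 3) → EuclideanSpace ℝ (Fin 3),
      (∀ x, V₀ (c • x) = c⁻¹ • V₀ x) ∧ (∀ g ∈ G, ∀ x, V₀ (g x) = g (V₀ x)) ∧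
      (∃ x, x ≠ 0 ∧ V₀ x ≠ 0) ∧
      ∃ V : ℝ → EuclideanSpace ℝ (Fin 3) → EuclideanSpace ℝ (Fin 3), InTraceClass V ∧ HasBlowupTrace V V₀

/-- Piece T2 (the `∀` half): TRACE RIGIDITY — backward uniqueness through a Type-I singular point:
two elements of the trace class with the same scar coincide at all negative times. -/
def TraceRigidity : Prop :=
  ∀ (V W : ℝ → EuclideanSpace ℝ (Fin 3) → EuclideanSpace ℝ (Fin 3))
    (V₀ : EuclideanSpace ℝ (Fin 3) → EuclideanSpace ℝ (Fin 3)),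
    InTraceClass V → InTraceClass W → HasBlowupTrace V V₀ → HasBlowupTrace W V₀ → ∀ t < 0, V t = W t

/-- Values at `t ≥ 0` are irrelevant to `IsAncientMildSolution`. -/
theorem isAncientMildSolution_congr {ν : ℝ}
    {u V : ℝ → EuclideanSpace ℝ (Fin 3) → EuclideanSpace ℝ (Fin 3)}
    (hV : IsAncientMildSolution ν V) (hu : ∀ t < 0, u t = V t) : IsAncientMildSolution ν u := by
  refine ⟨fun t ht => by rw [hu t ht]; exact hV.1 t ht, fun s t hst ht φ hφ hdiv => ?_⟩
  have hs : s < 0 := hst.trans ht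
  have hint : (∫ τ in s..t, ∫ x, inner ℝ (u τ x) (convect (u τ) (heatTest ν φ (t - τ)) x)) =
      ∫ τ in s..t, ∫ x, inner ℝ (V τ x) (convect (V τ) (heatTest ν φ (t - τ)) x) := by
    refine intervalIntegral.integral_congr fun τ hτ => ?_
    rw [Set.uIcc_of_le hst.le] at hτ
    have hτ0 : τ < 0 := lt_of_le_of_lt hτ.2 ht
    simp only [hu τ hτ0]
  rw [hu t ht, hu s hs, hint]
  exact hV.2 s t hst ht φ hφ hdiv

/-- Time dilation `t ↦ c² t` maps `t ↑ 0` to `t ↑ 0`. -/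
theorem tendsto_mul_sq_nhdsLT_zero {c : ℝ} (hc : 0 < c) :
    Tendsto (fun t : ℝ => c ^ 2 * t) (𝓝[<] (0 : ℝ)) (𝓝[<] (0 : ℝ)) := by
  refine tendsto_nhdsWithin_of_tendsto_nhds_of_eventually_within _ ?_ ?_
  · have h : Tendsto (fun t : ℝ => c ^ 2 * t) (𝓝 (0 : ℝ)) (𝓝 (c ^ 2 * 0)) :=
      tendsto_const_nhds.mul tendsto_id
    rw [mul_zero] at h
    exact h.mono_left nhdsWithin_le_nhds
  · filter_upwards [self_mem_nhdsWithin] with t ht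
    exact mul_neg_of_pos_of_neg (pow_pos hc 2) ht

/-- **ASSEMBLY of the scar/rigidity split (proved)**: symmetric scar attained + trace rigidity ⇒ the
crux. "Symmetric data + uniqueness ⇒ symmetric solution": the `λ`-rescaling and the `g`-conjugate
of the attaining field lie in the trace class and attain the SAME scar (homogeneity / equivariance
of the scar), so by rigidity they equal the field on `t < 0`; truncating at `t ≥ 0` gives an exactly
`λ`-DSS, `G`-equivariant, Type-I ancient mild solution, nontrivial because its scar is. -/
theorem polyhedralDssProfileExists_of_scar_rigidity
    (h1 : SymmetricScarAttained) (h2 : TraceRigidity) : PolyhedralDssProfileExists := by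
  obtain ⟨G, hfin, hdet, hirr, c, hc, V₀, hhom, hGV₀, ⟨x₀, hx₀, hV₀x₀⟩, V, ⟨C, C₀, hV, hD⟩, hT⟩ := h1
  have hc0 : 0 < c := one_pos.trans hc
  -- (1) the rescaled field attains the same scar, hence equals `V` on `t < 0`
  have hWcl : InTraceClass (nsRescale c V) := ⟨C, C₀, hV.nsRescale hc0, hD.nsRescale hc0⟩
  have hWtr : HasBlowupTrace (nsRescale c V) V₀ := by
    intro x hx
    have hcx : c • x ≠ 0 := smul_ne_zero hc0.ne' hx
    have h := ((hT (c • x) hcx).comp (tendsto_mul_sq_nhdsLT_zero hc0)).const_smul c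
    have e : c • V₀ (c • x) = V₀ x := by
      rw [hhom x, smul_smul, mul_inv_cancel₀ hc0.ne', one_smul]
    rw [e] at h
    exact h
  have hdssV : ∀ t < 0, V t = nsRescale c V t := h2 V (nsRescale c V) V₀ ⟨C, C₀, hV, hD⟩ hWcl hT hWtr
  -- (2) each `g`-conjugate attains the same scar, hence equals `V` on `t < 0`
  have heqvV : ∀ g ∈ G, ∀ t < 0, ∀ x, V t (g x) = g (V t x) := by
    intro g hg t ht x
    have hgcl : InTraceClass (fun t x => g (V t (g.symm x))) :=
      ⟨C, C₀, Theorems.SymmetryModuliCountSymmetricLiouville.isTypeIAncientMild_conj_linearIsometryEquiv hV g,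
        hD.conj_linearIsometryEquiv g⟩
    have hgtr : HasBlowupTrace (fun t x => g (V t (g.symm x))) V₀ := by
      intro y hy
      have hy' : g.symm y ≠ 0 := fun h => hy (by simpa using congrArg g h)
      have h := (g.continuous.tendsto _).comp (hT (g.symm y) hy')
      have e : g (V₀ (g.symm y)) = V₀ y := by
        rw [← hGV₀ g hg (g.symm y), LinearIsometryEquiv.apply_symm_apply]
      rw [e] at h
      exact h
    have key := congrFun (h2 V _ V₀ ⟨C, C₀, hV, hD⟩ hgcl hT hgtr t ht) (g x)
    simpa using key
  -- (3) truncate at `t ≥ 0` and read off the witness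
  set u : ℝ → EuclideanSpace ℝ (Fin 3) → EuclideanSpace ℝ (Fin 3) :=
    fun t => if t < 0 then V t else 0 with hu_def
  have hu : ∀ t < 0, u t = V t := fun t ht => by simp [hu_def, ht]
  have hu' : ∀ t, ¬ t < 0 → u t = 0 := fun t ht => by simp [hu_def, ht]
  refine ⟨G, hfin, hdet, hirr, c, hc, u, ?_, ?_, ?_, ⟨C₀, ?_⟩, ?_, ?_⟩
  · exact isAncientMildSolution_congr hV.isAncientMildSolution hu
  · intro t ht
    rw [hu t ht]
    exact hV.aestronglyMeasurable_slice ht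
  · show nsRescale c u = u
    funext t x
    rw [nsRescale_apply]
    by_cases ht : t < 0
    · have hct : c ^ 2 * t < 0 := mul_neg_of_pos_of_neg (by positivity) ht
      rw [hu _ hct, hu t ht]
      have key := congrFun (hdssV t ht) x
      rw [nsRescale_apply] at key
      exact key.symm
    · have hct : ¬ c ^ 2 * t < 0 := fun h => ht (by nlinarith [sq_nonneg c])
      rw [hu' _ hct, hu' t ht]
      simp
  · intro t ht x
    rw [hu t ht]
    exact hD t ht x
  · intro g hg t x
    by_cases ht : t < 0
    · rw [hu t ht]
      exact heqvV g hg t ht x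
    · rw [hu' t ht]
      simp
  · intro hzero
    apply hV₀x₀
    have hVt : ∀ t < 0, V t x₀ = 0 := by
      intro t ht
      have h := hzero t ht
      rw [hu t ht] at h
      have h' : V t = 0 :=
        (Continuous.ae_eq_iff_eq volume (hV.continuous_slice ht) continuous_const).1 h
      exact congrFun h' x₀
    refine tendsto_nhds_unique (hT x₀ hx₀) ?_
    refine tendsto_const_nhds.congr' ?_
    filter_upwards [self_mem_nhdsWithin] with t ht
    exact (hVt t ht).symm

end Summit.NavierStokesRegularity.NavierStokesRegularity.Cruxes.PolyhedralDssProfileExists.StrategistS19g3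

end
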